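import Mathlib
import HarnessLib
import Summits.ValiantsHypothesis.ValiantsHypothesis.Theorems.MonotoneRestorationOrbitRestorationLinearVolumeQPImpliesVH

/-!
# An unconditional polylog-separating linear-volume `VNP` pattern family, and the VNP-strengthening of R1 is FALSE

Route MonotoneRestoration, aside R1 = `OrbitRestorationLinearVolumeQP` (stmt-ValiantsHypothesis-18294).  The construction
inside `valiantsHypothesis_of_orbitRestorationLinearVolumeQP` (`…LinearVolumeQPImpliesVH.lean`) is recorded here as a
stand-alone existence theorem, and its first consequence for the shape of R1:

* `exists_separating_linearVolume_vnp_family` — THERE IS (unconditionally) a bipartite multigraph pattern family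
  `F_n = (Fin (a n) ⊔ Fin (b n), E n)` with `a n, b n, |E n| ≤ n + c₀` whose homomorphism polynomials form a `VNP`
  family and are POLYLOG-SEPARATING on `0/1` adjacency matrices (beyond every order two
  `≡^{C^{(log₂ m + c)^c}}`-equivalent graphs with different values) — Dawar–Wilsenach Thm 7.2 pairs + a separating
  generator of the permanent's hom expansion (`exists_pattern_separating`) + `HomPolyVNP.isVNPFamily_homPoly`;
  hence it has NO square-symmetric circuits of quasi-polynomial orbit size (`not_qpOrbitSymmetric_of_polylogSeparating`);
* `not_orbitRestorationLinearVolumeQP_vnp` — **R1 with `VNP` in place of `VP` is FALSE**: not every `VNP` family of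
  R1's class (poly-dimension linear-volume hom combination) has quasi-polynomial-orbit symmetric circuits.  So the
  `VP` hypothesis of R1 is used essentially (unless `VP = VNP`), exactly as for the parent crux (where the permanent
  witnesses it; the permanent is NOT in R1's class, `…LinearVolumeQPPerExcluded.lean`, so R1 needed its own witness);
* `linearVolumePolylogWidthVP_of_VP_eq_VNP` — under `VP = VNP` the kill construction `LinearVolumePolylogWidthVP` of
  `…/Negative/…FalseOfLinearVolumePolylogWidthVP.lean` exists (the contrapositive reading of R1 ⇒ VH).

Honest framing: tightness/placement; R1, the crux and VP ≠ VNP remain open.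
-/

noncomputable section

-- `Summit.ValiantsHypothesis.ValiantsHypothesis.…` is the tree's single-conjunct layout (Sub = Summit).
set_option linter.dupNamespace false

namespace Summit.ValiantsHypothesis.ValiantsHypothesis.Theorems

namespace OrbitRestorationLinearVolumeQPVHStrength

open MvPolynomial
open Summit.ValiantsHypothesis.ValiantsHypothesis.Theses.MonotoneRestoration
open Literature.Computability.AlgebraicComplexity
open Literature.ModelTheory.FiniteModelTheory

/-- **An unconditional polylog-separating linear-volume `VNP` pattern family.**  There are a constant `c₀` and
bipartite multigraph patterns `F_n = (Fin (a n) ⊔ Fin (b n), E n)` with `a n, b n, |E n| ≤ n + c₀` such that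
`(hom_{F_n,n})_n` is a `VNP` family and, for every `c` and beyond every order, two `≡^{C^{(log₂ m + c)^c}}`-equivalent
graphs on `Fin m` get different values of `hom_{F_m,m}` at their `0/1` adjacency matrices.  (At each Dawar–Wilsenach
order: a separating generator of the permanent's hom expansion; index `0` elsewhere.)
[cite: DawarWilsenach2025, Thm 7.2; DwivediPagoSeppelt2026, §4] -/
theorem exists_separating_linearVolume_vnp_family :
    ∃ (c₀ : ℕ) (a b : ℕ → ℕ) (E : (n : ℕ) → Multiset (Fin (a n) × Fin (b n))),
      (∀ n, a n ≤ n + c₀) ∧ (∀ n, b n ≤ n + c₀) ∧ (∀ n, Multiset.card (E n) ≤ n + c₀) ∧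
      IsVNPFamily (fun n => homPoly (E n) n ℂ) ∧
      ∀ c' N : ℕ, ∃ n : ℕ, N ≤ n ∧ ∃ X' Y' : SimpleGraph (Fin n),
        CkEquiv ((Nat.log 2 n + c') ^ c') X' Y' ∧
          eval (Set.indicator {ij : Fin n × Fin n | X'.Adj ij.1 ij.2} 1) (homPoly (E n) n ℂ) ≠
            eval (Set.indicator {ij : Fin n × Fin n | Y'.Adj ij.1 ij.2} 1) (homPoly (E n) n ℂ) := by
  classical
  -- adapted from `valiantsHypothesis_of_orbitRestorationLinearVolumeQP` (same construction)
  obtain ⟨c, hc⟩ := CFIMatching.DawarWilsenach2025_thm72_family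
  choose m hm X Y hXb hYb hXY hpm using hc
  have hne : ∀ k, eval (Set.indicator {ij : Fin (m k) × Fin (m k) | (X k).Adj ij.1 ij.2} 1)
      (perPoly (Fin (m k)) ℂ) ≠
      eval (Set.indicator {ij : Fin (m k) × Fin (m k) | (Y k).Adj ij.1 ij.2} 1) (perPoly (Fin (m k)) ℂ) := by
    intro k
    obtain ⟨s, t, hs, hst⟩ := hXb k
    obtain ⟨s', t', hs', hst'⟩ := hYb k
    rw [indicator_adj_eq, indicator_adj_eq]
    exact eval_perPoly_adj_ne_of_card_perfectMatchings_ne hs hst hs' hst' ℂ (hpm k)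
  have hkm : ∀ k, k < m k := by
    intro k
    by_contra hk
    have hk' : m k ≤ k := not_lt.mp hk
    apply hpm k
    rcases Nat.eq_zero_or_pos (m k) with h0 | hpos
    · have hXYeq : X k = Y k := by
        ext u v
        exact absurd u.isLt (by omega)
      rw [hXYeq]
    · rcases Nat.eq_zero_or_pos k with hk0 | hkpos
      · omega
      · obtain ⟨e⟩ := (hXY k).nonempty_iso hkpos (by simpa using hk')
        exact Literature.Probability.LatticeModels.card_perfectMatchings_eq_of_iso e
  choose a b E ha hb hE hsepk using fun k => exists_pattern_separating (m k) (X k) (Y k) (hne k)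
  let ksel : ℕ → ℕ := fun n => if h : ∃ k, m k = n then h.choose else 0
  have hksel : ∀ k, m (ksel (m k)) = m k := by
    intro k
    have h : ∃ k', m k' = m k := ⟨k, rfl⟩
    simp only [ksel, dif_pos h]
    exact h.choose_spec
  have hm0 : m 0 ≤ c := by simpa using hm 0
  have hsize : ∀ n, a (ksel n) ≤ n + c ∧ b (ksel n) ≤ n + c ∧ Multiset.card (E (ksel n)) ≤ n + c := by
    intro n
    by_cases h : ∃ k, m k = n
    · have hk : m (ksel n) = n := by
        simp only [ksel, dif_pos h]
        exact h.choose_spec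
      have h1 := ha (ksel n); have h2 := hb (ksel n); have h3 := hE (ksel n)
      rw [hk] at h1 h2 h3
      exact ⟨by omega, by omega, by omega⟩
    · have hk0 : ksel n = 0 := by simp only [ksel, dif_neg h]
      rw [hk0]
      have h1 := ha 0; have h2 := hb 0; have h3 := hE 0
      exact ⟨by omega, by omega, by omega⟩
  refine ⟨c, fun n => a (ksel n), fun n => b (ksel n), fun n => E (ksel n), fun n => (hsize n).1,
    fun n => (hsize n).2.1, fun n => (hsize n).2.2, ?_, fun c' N => ?_⟩
  · refine HomPolyVNP.isVNPFamily_homPoly ℂ (fun n => a (ksel n)) (fun n => b (ksel n)) (fun n => E (ksel n))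
      (c + 1) (fun n => ?_) (fun n => ?_) (fun n => ?_)
    all_goals
      have hpow : n + c ≤ (n + 2) ^ (c + 1) := by
        have h5 : 2 ^ c ≤ (n + 2) ^ c := Nat.pow_le_pow_left (by omega) _
        have h4 : c ≤ 2 ^ c := Nat.lt_two_pow_self.le
        calc n + c ≤ (n + 2) * (n + 2) ^ c := by nlinarith [Nat.one_le_pow c (n + 2) (by omega)]
          _ = (n + 2) ^ (c + 1) := by ring
    · exact (hsize n).1.trans hpow
    · exact (hsize n).2.1.trans hpow
    · exact (hsize n).2.2.trans hpow
  · obtain ⟨k₁, hk₁⟩ := symmetricLB_logPow_lt c' (δ := 1 / (2 * (c : ℝ) + 2)) (by positivity)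
    obtain ⟨M₀, hM₀N, hM₀K⟩ : ∃ M₀ : ℕ, N ≤ M₀ ∧ 2 ^ k₁ ≤ M₀ :=
      ⟨max N (2 ^ k₁), le_max_left _ _, le_max_right _ _⟩
    obtain ⟨k₀, hk₀_def⟩ : ∃ k₀ : ℕ, k₀ = M₀ + c + 1 := ⟨_, rfl⟩
    obtain ⟨k', hk'_def⟩ : ∃ k' : ℕ, k' = ksel (m k₀) := ⟨_, rfl⟩
    have hmk' : m k' = m k₀ := by rw [hk'_def]; exact hksel k₀
    have hk₀m : k₀ < m k₀ := hkm k₀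
    have hsel : ksel (m k') = k' := by rw [hmk', hk'_def]
    have hk'1 : 1 ≤ k' := by
      by_contra h0
      have hz : k' = 0 := by omega
      have : m k' ≤ c := by rw [hz]; exact hm0
      omega
    refine ⟨m k', by omega, X k', Y k', ?_, ?_⟩
    · refine (hXY k').mono ?_
      have h2 : 2 ^ k₁ ≤ m k' := hM₀K.trans (by omega)
      have hlt := hk₁ (m k') h2
      have hmle : ((m k' : ℕ) : ℝ) ≤ (c : ℝ) * (k' : ℝ) + (c : ℝ) := by exact_mod_cast hm k'
      have hk1r : (1 : ℝ) ≤ (k' : ℝ) := by exact_mod_cast hk'1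
      have hc0 : (0 : ℝ) ≤ (c : ℝ) := Nat.cast_nonneg c
      have h3 : 1 / (2 * (c : ℝ) + 2) * ((m k' : ℕ) : ℝ) ≤ (k' : ℝ) := by
        rw [one_div, inv_mul_le_iff₀ (by positivity)]
        nlinarith [mul_nonneg hc0 (sub_nonneg.mpr hk1r)]
      have h4 : ((Nat.log 2 (m k') + c') ^ c' : ℝ) < (k' : ℝ) := hlt.trans_le h3
      have h5 : (((Nat.log 2 (m k') + c') ^ c' : ℕ) : ℝ) < (k' : ℝ) := by push_cast; exact h4
      exact (by exact_mod_cast h5 : (Nat.log 2 (m k') + c') ^ c' < k').le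
    · show eval _ (homPoly (E (ksel (m k'))) (m k') ℂ) ≠ eval _ (homPoly (E (ksel (m k'))) (m k') ℂ)
      rw [hsel]
      exact hsepk k'

/-- **R1 with `VNP` in place of `VP` is FALSE** (unconditionally): not every `VNP` family that is, level by level, a
combination of `≤ (n+2)^c` homomorphism polynomials of bipartite patterns with `≤ c (n+1)` vertices has
square-symmetric circuits of orbit size `2^{(log₂ n + c')^{c'}}` — the separating family of
`exists_separating_linearVolume_vnp_family` (one pattern per level) is such a family with no such circuits
(orbit-form Dawar–Wilsenach pipeline).  The `VP` hypothesis of R1 is therefore essential unless `VP = VNP`.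
[cite: DawarWilsenach2025, Thm 7.2, Thm 5.1, §6, §7.1] -/
theorem not_orbitRestorationLinearVolumeQP_vnp :
    ¬ ∀ f : (n : ℕ) → MvPolynomial (Fin n × Fin n) ℂ, IsVNPFamily f →
      (∃ (c : ℕ) (m : ℕ → ℕ) (a b : (n : ℕ) → Fin (m n) → ℕ)
          (E : (n : ℕ) → (i : Fin (m n)) → Multiset (Fin (a n i) × Fin (b n i)))
          (α : (n : ℕ) → Fin (m n) → ℂ),
        (∀ n, m n ≤ (n + 2) ^ c) ∧ (∀ n i, a n i + b n i ≤ c * (n + 1)) ∧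
          ∀ n, f n = ∑ i : Fin (m n), MvPolynomial.C (α n i) * homPoly (E n i) n ℂ) →
      ∃ c : ℕ, ∀ n : ℕ, ∃ (G : Type) (_ : Fintype G) (C : LabelledArithCircuit ℂ (Fin n × Fin n) Unit G),
        C.IsSymmetric (Equiv.Perm (Fin n)) ∧ C.eval (C.output ()) = f n ∧
          C.orbitSize (Equiv.Perm (Fin n)) ≤ 2 ^ ((Nat.log 2 n + c) ^ c) := by
  intro h
  obtain ⟨c₀, a, b, E, ha, hb, -, hVNP, hsep⟩ := exists_separating_linearVolume_vnp_family
  refine not_qpOrbitSymmetric_of_polylogSeparating (fun n => homPoly (E n) n ℂ) hsep (h _ hVNP ?_)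
  -- the single-pattern family is in R1's class: dimension `1`, volume `a n + b n ≤ 2n + 2c₀ ≤ (2c₀ + 2)(n + 1)`
  refine ⟨2 * c₀ + 2, fun _ => 1, fun n _ => a n, fun n _ => b n, fun n _ => E n, fun _ _ => 1,
    fun n => Nat.one_le_pow _ _ (by omega), fun n _ => ?_, fun n => by simp⟩
  have h1 := ha n; have h2 := hb n
  nlinarith

/-- **Under `VP = VNP` the kill construction exists**: `VP ℂ = VNP ℂ → LinearVolumePolylogWidthVP` (the
contrapositive content of `valiantsHypothesis_of_orbitRestorationLinearVolumeQP`, made explicit: the separating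
`VNP` family is then a `VP` family of R1's class). [cite: DawarWilsenach2025, Thm 7.2] -/
theorem linearVolumePolylogWidthVP_of_VP_eq_VNP (hEq : VP ℂ = VNP ℂ) : LinearVolumePolylogWidthVP := by
  obtain ⟨c₀, a, b, E, ha, hb, -, hVNP, hsep⟩ := exists_separating_linearVolume_vnp_family
  refine linearVolumePolylogWidthVP_of_single a b E (2 * c₀ + 2) (fun n => ?_)
    (isVPFamily_of_isVNPFamily_of_VP_eq_VNP hEq hVNP) hsep
  have h1 := ha n; have h2 := hb n
  nlinarith

end OrbitRestorationLinearVolumeQPVHStrength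

end Summit.ValiantsHypothesis.ValiantsHypothesis.Theorems

end
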